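import Literature.MathematicalPhysics.QuantumFieldTheory.TomboulisYaffeInequality
import Literature.MathematicalPhysics.QuantumFieldTheory.CentralTwistFluxRemoval
import HarnessLib

/-!
# Crux `IR` (stmt-QuantumFields-19354), line `tension-ratio` (flux currency): the junction
# 't Hooft electric-flux deficit ⇒ dyadic Wilson area law (seam), and the strong-coupling rung for EVERY central twist

Helper module for item `stmt-QuantumFields-19354` (`--supports … --as helper`; RULING g9-№2: critic-named sorry-free kernel content
with NO Theses conclusion — ym-ir-crit-1 02:54:36Z «the PROVED rung `dyadicAreaLaw_strongCoupling` … bankable as a Theorems file»,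
co-sign rider (1) 03:34:54Z «LAND … dyadicAreaLaw_strongCoupling»).  It is the `sorry`-free part of the alternative skeleton
`Cruxes/IR/Lines/ym_ir7_tension_ratio_flux.lean` (af546c84e492, ideator ym-ir-idea-7 g4), with the rung GENERALISED from a central
involution (`z² = 1`, tree `CentralTwist.one_sub_twistedPartitionFunction_div_le`) to an ARBITRARY non-trivially represented central element
(tree `CentralTwist.one_sub_twistedPartitionFunction_div_le_of_central`), so that every `SU(N)`, `N ≥ 2` — in particular the odd `N`, whose centre
`ℤ_N` has no involution — is covered (`sun_dyadicAreaLaw_strongCoupling`).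

Contents (namespace `Summit.QuantumFields.YangMills.Cruxes.IR.TensionRatio.Flux`; the skeleton re-bases on this file by deleting its copies):
* §0 vocabulary: `fluxDeficit ρ β L z q = 1 − Z_{β,L}(z;q)∕Z_{β,L}(1;q)` ('t Hooft's electric-flux deficit of the `ρ`-Wilson action on
  `(ℤ∕Lℤ)^d`, tree `twistedPartitionFunction`), `plane01`, `DyadicAreaLaw ρ π β L n K s` (every `2^a × 2^b` loop, `a,b ≤ n`, in the
  `(0,1)` plane of the 4-torus of side `L = 2^(n+1)`, loops in `π`, state of the `ρ`-action: `|⟨W⟩| ≤ K e^{−s·2^a·2^b}`);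
* §1 arithmetic: `sq_mul_exp_le` (`x² e^{−2κx²} ≤ e^{−κx²}` for `x ≥ 2∕κ`), `areaBound_of_twistShape` (a Tomboulis–Yaffe-shaped bound
  `|W| ≤ M^{2h∕L} ε^{hw∕L²}` with `ε ≤ A e^{−σL²}` gives `|W| ≤ M·A·e^{−σhw}` for loops up to half the side), `dyadic_ge_of_le`;
* §2 the junction (real proofs): `fluxDeficit_nonneg` (RP, tree), `ty_self` (the `π = ρ` Tomboulis–Yaffe inequality IS the tree theorem
  `TomboulisYaffe.wilsonLoop_abs_le_twist`), ★ `dyadicAreaLaw_of_flux`: a TY-shaped bound for the dyadic loops + a flux deficit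
  `≤ C_F·L²·e^{−2κL²}` + `L ≥ 2∕κ` ⇒ `DyadicAreaLaw` with CONSTANT prefactor `M(1 + 8|C_F|∕‖1−ω‖²)` and rate `κ` — Tomboulis–Yaffe §II's
  remark «vortex free energy vanishing like `e^{−σL²}` ⇒ area law» as a theorem on finite tori;
* §3 strong coupling (real proofs, in-regime FORMAT rungs): ★ `dyadicAreaLaw_strongCoupling_of_central` — second-countable compact `G`,
  continuous `N`-dimensional `ρ`, ANY central `z` with `ρ z = ω·1`, `‖ω‖ = 1`, `ω ≠ 1`, `|β| ≤ 1∕(4N·25²·e²)`: on every dyadic 4-torus of side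
  `L = 2^(n+1) ≥ 8` every dyadic loop up to half the side obeys `|⟨W_{h×w}⟩_L| ≤ N(1 + 256∕‖1−ω‖²) e^{−hw∕4}`; `dyadicAreaLaw_strongCoupling`
  (the involution form of the skeleton, now a corollary); `centerPhase_ne_one`; ★★ `sun_dyadicAreaLaw_strongCoupling` — the `SU(N)` fundamental
  Wilson action, every `N ≥ 2`, twist `e^{2πi∕N}·1`.

HONEST FRAMING: strong coupling only (`|β| ≤ 1∕(4N·25²e²)`), symmetric dyadic tori only; a format rung inside `IR`'s KNOWN regime
(Osterwalder–Seiler 1978) and the junction seam of the line — NOT a witness of weakness of the line's stub `ElectricFluxFloor` (confinement in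
units at weak coupling, open), nothing about `β → ∞`, the crux `IR`, `BalabanLadder`, or the Yang–Mills mass gap (Clay), which are NOT proved
here or anywhere in the tree; R4 closes only the conditional finite-𝕋⁴ rung `BalabanLadder.UV`.

References: G. 't Hooft, Nucl. Phys. B 153 (1979) 141, §2; E. T. Tomboulis, L. G. Yaffe, Commun. Math. Phys. 100 (1985) 313, §II + App. I
(tree `TomboulisYaffeInequality.lean`); K. R. Ito, E. Seiler, arXiv:0803.3019 Thm 2.2 (1); E. T. Tomboulis, arXiv:0707.2179 §6.2 (tree
`CentralTwistFluxRemoval.lean`); K. Osterwalder, E. Seiler, Ann. Phys. 110 (1978) 440 §5; card `Cruxes/IR/Lines/ym-ir7-tension-ratio.md`.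
-/

set_option autoImplicit false

noncomputable section

open Filter Topology MeasureTheory
open Literature.MathematicalPhysics.QuantumFieldTheory
open Literature.MathematicalPhysics.QuantumLattice (centerPhase suCenter fundamentalRep continuous_fundamentalRep coe_suCenter
  fundamentalRep_apply norm_centerPhase)

namespace Summit.QuantumFields.YangMills.Cruxes.IR.TensionRatio.Flux

/-! ## §0 Vocabulary -/

section Defs

variable {G : Type} [Group G] [TopologicalSpace G] [IsTopologicalGroup G] [CompactSpace G]
  [MeasurableSpace G] [BorelSpace G]

/-- 't Hooft's electric-flux DEFICIT `1 − Z_{β,L}(z; q) ∕ Z_{β,L}(1; q)` of the `ρ`-Wilson action on the torus `(ℤ∕Lℤ)^d` (tree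
`twistedPartitionFunction`; `= 1 − e^{−F_mag}` in Tomboulis–Yaffe's notation). -/
def fluxDeficit {d N : ℕ} (ρ : G →* Matrix (Fin N) (Fin N) ℂ) (β : ℝ) (L : ℕ) [NeZero L] (z : G)
    (q : {p : Fin d × Fin d // p.1 < p.2}) : ℝ :=
  1 - twistedPartitionFunction ρ β L z q / twistedPartitionFunction ρ β L 1 q

/-- The `(0,1)` coordinate plane of the 4-torus. -/
def plane01 : {p : Fin 4 × Fin 4 // p.1 < p.2} := ⟨((0 : Fin 4), (1 : Fin 4)), by decide⟩

/-- Dyadic area law with CONSTANT prefactor `K` and areal rate `s` on the 4-torus of side `L = 2^(n+1)`: every `2^a × 2^b` loop in the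
`(0,1)` plane (`a, b ≤ n`, i.e. up to half the side), loops in the representation `π`, state of the `ρ`-Wilson action. -/
def DyadicAreaLaw {N M : ℕ} (ρ : G →* Matrix (Fin N) (Fin N) ℂ) (π : G →* Matrix (Fin M) (Fin M) ℂ) (β : ℝ)
    (L : ℕ) [NeZero L] (n : ℕ) (K s : ℝ) : Prop :=
  ∀ a b : ℕ, a ≤ n → b ≤ n →
    |wilsonExpectation ρ β (wilsonLoop π (0 : Site 4 L) 0 1 (2 ^ a) (2 ^ b))| ≤ K * Real.exp (-(s * 2 ^ a * 2 ^ b))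

end Defs

/-! ## §1 Arithmetic (no gauge theory) -/

section Arith

/-- **No polynomial prefactor, eventually:** for `κ > 0` and `x ≥ 2∕κ`, `x² · e^{−2κx²} ≤ e^{−κx²}`. -/
theorem sq_mul_exp_le {κ x : ℝ} (hκ : 0 < κ) (hx : 2 / κ ≤ x) :
    x ^ 2 * Real.exp (-(2 * κ * x ^ 2)) ≤ Real.exp (-(κ * x ^ 2)) := by
  have hx0 : 0 ≤ x := le_trans (by positivity) hx
  have hκx : 2 ≤ κ * x := by
    have h := mul_le_mul_of_nonneg_left hx hκ.le
    rwa [mul_div_cancel₀ _ hκ.ne'] at h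
  -- `x² ≤ exp(κ x²)`: `exp y ≥ (1 + y/2)² ≥ y²/4` and `x² ≤ (κx²)²/4` since `κx ≥ 2`
  have hy0 : 0 ≤ κ * x ^ 2 / 2 + 1 := by positivity
  have h1 : κ * x ^ 2 / 2 + 1 ≤ Real.exp (κ * x ^ 2 / 2) := Real.add_one_le_exp _
  have h2 : (κ * x ^ 2 / 2 + 1) ^ 2 ≤ Real.exp (κ * x ^ 2) := by
    have h := pow_le_pow_left₀ hy0 h1 2
    rwa [← Real.exp_nat_mul, show ((2 : ℕ) : ℝ) * (κ * x ^ 2 / 2) = κ * x ^ 2 by push_cast; ring] at h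
  have h3 : x ^ 2 ≤ (κ * x ^ 2 / 2 + 1) ^ 2 := by
    have hkx2 : 4 ≤ (κ * x) ^ 2 := by nlinarith
    nlinarith [sq_nonneg x, sq_nonneg (κ * x)]
  have h4 : x ^ 2 ≤ Real.exp (κ * x ^ 2) := h3.trans h2
  have hsplit : Real.exp (-(2 * κ * x ^ 2)) = Real.exp (-(κ * x ^ 2)) * Real.exp (-(κ * x ^ 2)) := by
    rw [← Real.exp_add]; ring_nf
  have hinv : Real.exp (κ * x ^ 2) * Real.exp (-(κ * x ^ 2)) = 1 := by
    rw [← Real.exp_add, add_neg_cancel, Real.exp_zero]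
  calc x ^ 2 * Real.exp (-(2 * κ * x ^ 2))
      = x ^ 2 * Real.exp (-(κ * x ^ 2)) * Real.exp (-(κ * x ^ 2)) := by rw [hsplit, mul_assoc]
    _ ≤ Real.exp (κ * x ^ 2) * Real.exp (-(κ * x ^ 2)) * Real.exp (-(κ * x ^ 2)) := by
        gcongr
    _ = Real.exp (-(κ * x ^ 2)) := by rw [hinv, one_mul]

/-- **The arithmetic of the junction:** a Tomboulis–Yaffe-shaped bound `|W| ≤ M^{2h∕L} ε^{hw∕L²}` with `0 ≤ ε ≤ A·e^{−σL²}`, `A ≥ 1`,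
`1 ≤ M`, `2h ≤ L`, `2w ≤ L` gives the constant-prefactor area-law bound `|W| ≤ M·A·e^{−σhw}`. -/
theorem areaBound_of_twistShape {W ε A σ : ℝ} {M L h w : ℕ} (hM : 1 ≤ M) (hL : 0 < L) (h2h : 2 * h ≤ L) (h2w : 2 * w ≤ L)
    (hε0 : 0 ≤ ε) (hA : 1 ≤ A) (hεA : ε ≤ A * Real.exp (-(σ * (L : ℝ) ^ 2)))
    (hW : |W| ≤ (M : ℝ) ^ (((2 * h : ℕ) : ℝ) / L) * ε ^ (((h * w : ℕ) : ℝ) / (L : ℝ) ^ 2)) :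
    |W| ≤ M * A * Real.exp (-(σ * h * w)) := by
  have hL0 : (0 : ℝ) < L := by exact_mod_cast hL
  have hM1 : (1 : ℝ) ≤ M := by exact_mod_cast hM
  -- exponents
  have ht₁ : ((2 * h : ℕ) : ℝ) / L ≤ 1 := by
    rw [div_le_one hL0]; exact_mod_cast h2h
  have ht₂0 : 0 ≤ ((h * w : ℕ) : ℝ) / (L : ℝ) ^ 2 := by positivity
  have ht₂ : ((h * w : ℕ) : ℝ) / (L : ℝ) ^ 2 ≤ 1 := by
    rw [div_le_one (by positivity)]
    have hh : (2 * h : ℝ) ≤ L := by exact_mod_cast h2h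
    have hw : (2 * w : ℝ) ≤ L := by exact_mod_cast h2w
    push_cast
    nlinarith
  -- `M^{2h/L} ≤ M`
  have hMt : (M : ℝ) ^ (((2 * h : ℕ) : ℝ) / L) ≤ M := by
    have h := Real.rpow_le_rpow_of_exponent_le hM1 ht₁
    rwa [Real.rpow_one] at h
  -- `ε^{hw/L²} ≤ A · e^{-σ h w}`
  have hAe0 : 0 ≤ A * Real.exp (-(σ * (L : ℝ) ^ 2)) := by positivity
  have hεt : ε ^ (((h * w : ℕ) : ℝ) / (L : ℝ) ^ 2) ≤ A * Real.exp (-(σ * h * w)) := by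
    calc ε ^ (((h * w : ℕ) : ℝ) / (L : ℝ) ^ 2)
        ≤ (A * Real.exp (-(σ * (L : ℝ) ^ 2))) ^ (((h * w : ℕ) : ℝ) / (L : ℝ) ^ 2) :=
          Real.rpow_le_rpow hε0 hεA ht₂0
      _ = A ^ (((h * w : ℕ) : ℝ) / (L : ℝ) ^ 2) *
            Real.exp (-(σ * (L : ℝ) ^ 2)) ^ (((h * w : ℕ) : ℝ) / (L : ℝ) ^ 2) :=
          Real.mul_rpow (by linarith) (Real.exp_pos _).le
      _ ≤ A * Real.exp (-(σ * h * w)) := by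
          have hA1 : A ^ (((h * w : ℕ) : ℝ) / (L : ℝ) ^ 2) ≤ A := by
            have h := Real.rpow_le_rpow_of_exponent_le hA ht₂
            rwa [Real.rpow_one] at h
          have hE : Real.exp (-(σ * (L : ℝ) ^ 2)) ^ (((h * w : ℕ) : ℝ) / (L : ℝ) ^ 2) = Real.exp (-(σ * h * w)) := by
            rw [← Real.exp_mul]
            congr 1
            push_cast
            field_simp
          rw [hE]
          exact mul_le_mul_of_nonneg_right hA1 (Real.exp_pos _).le
  calc |W| ≤ (M : ℝ) ^ (((2 * h : ℕ) : ℝ) / L) * ε ^ (((h * w : ℕ) : ℝ) / (L : ℝ) ^ 2) := hW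
    _ ≤ M * (A * Real.exp (-(σ * h * w))) :=
        mul_le_mul hMt hεt (Real.rpow_nonneg hε0 _) (by positivity)
    _ = M * A * Real.exp (-(σ * h * w)) := by ring

/-- Dyadic sides are eventually larger than any threshold: `2^(n+1) ≥ X` once `n ≥ ⌈X⌉₊`. -/
theorem dyadic_ge_of_le {X : ℝ} {n L : ℕ} (hL : L = 2 ^ (n + 1)) (hn : ⌈X⌉₊ ≤ n) : X ≤ (L : ℝ) := by
  have h1 : X ≤ (⌈X⌉₊ : ℝ) := Nat.le_ceil X
  have h2 : (⌈X⌉₊ : ℝ) ≤ n := by exact_mod_cast hn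
  have h3 : (n : ℝ) ≤ L := by
    have : n < 2 ^ (n + 1) := lt_trans Nat.lt_two_pow_self (Nat.pow_lt_pow_right (by norm_num) (Nat.lt_succ_self n))
    rw [hL]; exact_mod_cast this.le
  linarith

end Arith

/-! ## §2 The junction: flux deficit ⇒ dyadic area law (real proofs) -/

section Junction

variable {G : Type} [Group G] [TopologicalSpace G] [IsTopologicalGroup G] [CompactSpace G]
  [MeasurableSpace G] [BorelSpace G]

/-- The flux deficit is non-negative on even tori (tree: `Z(z) ≤ Z(1)` by reflection positivity, `Z > 0`). -/
theorem fluxDeficit_nonneg {d N : ℕ} [NeZero d] (ρ : G →* Matrix (Fin N) (Fin N) ℂ) (hρ : Continuous ρ) (β : ℝ)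
    {L : ℕ} [NeZero L] (hL : Even L) {z : G} (hz : z ∈ Subgroup.center G) (q : {p : Fin d × Fin d // p.1 < p.2}) :
    0 ≤ fluxDeficit ρ β L z q := by
  unfold fluxDeficit
  have h1 : twistedPartitionFunction ρ β L z q / twistedPartitionFunction ρ β L 1 q ≤ 1 :=
    (div_le_one (twistedPartitionFunction_pos ρ hρ β 1 _)).2
      (twistedPartitionFunction_le_untwisted_plane ρ β hL hρ hz _)
  linarith

/-- **The `π = ρ` Tomboulis–Yaffe inequality in the `fluxDeficit` vocabulary IS the tree theorem**
`TomboulisYaffe.wilsonLoop_abs_le_twist` (loops in the action's own representation). -/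
theorem ty_self (d L N : ℕ) [NeZero d] [NeZero L] (ρ : G →* Matrix (Fin N) (Fin N) ℂ) (hρ : Continuous ρ)
    (n : ℕ) (hL : L = 2 ^ (n + 1)) (β : ℝ) (j : Fin d) (hj : (0 : Fin d) < j) (z : G) (hz : z ∈ Subgroup.center G)
    (ω : ℂ) (hω : ρ z = ω • (1 : Matrix (Fin N) (Fin N) ℂ)) (hω1 : ‖ω‖ = 1) (hne : ω ≠ 1)
    (a b : ℕ) (ha : a ≤ n) (hb : b ≤ n) :
    |wilsonExpectation ρ β (wilsonLoop ρ (0 : Site d L) 0 j (2 ^ a) (2 ^ b))| ≤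
      (N : ℝ) ^ (((2 * 2 ^ a : ℕ) : ℝ) / L) *
        (8 * fluxDeficit ρ β L z ⟨(0, j), hj⟩ / ‖1 - ω‖ ^ 2) ^ (((2 ^ a * 2 ^ b : ℕ) : ℝ) / (L : ℝ) ^ 2) :=
  TomboulisYaffe.wilsonLoop_abs_le_twist ρ n hL hρ β hj hz hω hω1 hne a b ha hb

/-- **The junction, per `(β, L)` (real proof):** a TY-shaped loop bound for all dyadic loops (for `π = ρ` it is `ty_self`), a flux deficit
`≤ C_F·L²·e^{−2κL²}` and `L ≥ 2∕κ` give the dyadic area law with prefactor `M·(1 + 8|C_F|∕‖1−ω‖²)` and rate `κ`. -/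
theorem dyadicAreaLaw_of_flux {N M : ℕ} (ρ : G →* Matrix (Fin N) (Fin N) ℂ) (π : G →* Matrix (Fin M) (Fin M) ℂ)
    (hρ : Continuous ρ) (hM : 0 < M) {β : ℝ} {L : ℕ} [NeZero L] {n : ℕ} (hL : L = 2 ^ (n + 1))
    {z : G} (hz : z ∈ Subgroup.center G) {ω : ℂ} (hne : ω ≠ 1) {CF κ : ℝ} (hκ : 0 < κ) (hLκ : 2 / κ ≤ (L : ℝ))
    (hTY : ∀ a b : ℕ, a ≤ n → b ≤ n →
      |wilsonExpectation ρ β (wilsonLoop π (0 : Site 4 L) 0 1 (2 ^ a) (2 ^ b))| ≤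
        (M : ℝ) ^ (((2 * 2 ^ a : ℕ) : ℝ) / L) *
          (8 * fluxDeficit ρ β L z plane01 / ‖1 - ω‖ ^ 2) ^ (((2 ^ a * 2 ^ b : ℕ) : ℝ) / (L : ℝ) ^ 2))
    (hF : fluxDeficit ρ β L z plane01 ≤ CF * (L : ℝ) ^ 2 * Real.exp (-(2 * κ * (L : ℝ) ^ 2))) :
    DyadicAreaLaw ρ π β L n (M * (1 + 8 * |CF| / ‖1 - ω‖ ^ 2)) κ := by
  intro a b ha hb
  have hLe : Even L := ⟨2 ^ n, by rw [hL, pow_succ]; ring⟩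
  have hLpos : 0 < L := Nat.pos_of_ne_zero (NeZero.ne L)
  have hL2 : L / 2 = 2 ^ n := by rw [hL, pow_succ, Nat.mul_div_cancel _ two_pos]
  have hω2 : 0 < ‖1 - ω‖ ^ 2 := by
    have : 1 - ω ≠ 0 := sub_ne_zero.2 (Ne.symm hne)
    positivity
  have hδ0 : 0 ≤ fluxDeficit ρ β L z plane01 := fluxDeficit_nonneg ρ hρ β hLe hz _
  -- the deficit without its polynomial prefactor
  have hδ : fluxDeficit ρ β L z plane01 ≤ |CF| * Real.exp (-(κ * (L : ℝ) ^ 2)) := by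
    have hsq := sq_mul_exp_le hκ hLκ
    calc fluxDeficit ρ β L z plane01 ≤ CF * (L : ℝ) ^ 2 * Real.exp (-(2 * κ * (L : ℝ) ^ 2)) := hF
      _ ≤ |CF| * ((L : ℝ) ^ 2 * Real.exp (-(2 * κ * (L : ℝ) ^ 2))) := by
          rw [mul_assoc]; exact mul_le_mul_of_nonneg_right (le_abs_self CF) (by positivity)
      _ ≤ |CF| * Real.exp (-(κ * (L : ℝ) ^ 2)) := mul_le_mul_of_nonneg_left hsq (abs_nonneg CF)
  -- `ε ≤ A e^{-κ L²}`
  set A : ℝ := 1 + 8 * |CF| / ‖1 - ω‖ ^ 2 with hA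
  have hA0 : 0 ≤ 8 * |CF| / ‖1 - ω‖ ^ 2 := by positivity
  have hA1 : 1 ≤ A := by rw [hA]; linarith
  have hε0 : 0 ≤ 8 * fluxDeficit ρ β L z plane01 / ‖1 - ω‖ ^ 2 := by positivity
  have hεA : 8 * fluxDeficit ρ β L z plane01 / ‖1 - ω‖ ^ 2 ≤ A * Real.exp (-(κ * (L : ℝ) ^ 2)) := by
    have hE := Real.exp_pos (-(κ * (L : ℝ) ^ 2))
    calc 8 * fluxDeficit ρ β L z plane01 / ‖1 - ω‖ ^ 2
        ≤ 8 * (|CF| * Real.exp (-(κ * (L : ℝ) ^ 2))) / ‖1 - ω‖ ^ 2 := by gcongr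
      _ = (8 * |CF| / ‖1 - ω‖ ^ 2) * Real.exp (-(κ * (L : ℝ) ^ 2)) := by ring
      _ ≤ A * Real.exp (-(κ * (L : ℝ) ^ 2)) := by
          refine mul_le_mul_of_nonneg_right ?_ hE.le
          rw [hA]; linarith
  have h2a : 2 * 2 ^ a ≤ L := by
    rw [hL, pow_succ']; exact Nat.mul_le_mul_left 2 (Nat.pow_le_pow_right two_pos ha)
  have h2b : 2 * 2 ^ b ≤ L := by
    rw [hL, pow_succ']; exact Nat.mul_le_mul_left 2 (Nat.pow_le_pow_right two_pos hb)
  have key := areaBound_of_twistShape (M := M) (h := 2 ^ a) (w := 2 ^ b) hM hLpos h2a h2b hε0 hA1 hεA (hTY a b ha hb)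
  simpa [Nat.cast_pow, Nat.cast_ofNat, mul_assoc] using key

end Junction

/-! ## §3 Strong coupling: the vortex free energy (tree, ANY central twist) through the junction — in-regime FORMAT rungs -/

section StrongCoupling

variable {G : Type} [Group G] [TopologicalSpace G] [IsTopologicalGroup G] [CompactSpace G]
  [MeasurableSpace G] [BorelSpace G] [SecondCountableTopology G]

/-- **Strong coupling, ANY non-trivially represented central twist: vortex bound ⇒ dyadic area law (no `sorry`).**  For `|β| ≤ 1∕(4N·25²·e²)`
the tree's `CentralTwist.one_sub_twistedPartitionFunction_div_le_of_central` (Tomboulis 2007 §6.2: the flux is removed by a change of variables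
on simply-connected polymers; no hypothesis on the order of `z`) gives the flux deficit `≤ 32·L²·e^{−L²∕2}` on every 4-torus; through `ty_self`
and `dyadicAreaLaw_of_flux` (κ = 1∕4, `L ≥ 8`): every dyadic loop up to half the side of the dyadic torus obeys
`|⟨W_{h×w}⟩_L| ≤ N·(1 + 256∕‖1−ω‖²)·e^{−hw∕4}`.  Inside `IR`'s known regime (Osterwalder–Seiler 1978); not a witness of weakness. -/
theorem dyadicAreaLaw_strongCoupling_of_central {N : ℕ} (ρ : G →* Matrix (Fin N) (Fin N) ℂ)
    (hρ : Continuous ρ) (hN : 0 < N) {z : G} (hz : z ∈ Subgroup.center G) {ω : ℂ}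
    (hω : ρ z = ω • (1 : Matrix (Fin N) (Fin N) ℂ)) (hω1 : ‖ω‖ = 1) (hne : ω ≠ 1) {β : ℝ}
    (hβ : |β| ≤ 1 / (4 * N * ((((8 * (4 - 1) : ℕ) : ℝ) + 1) ^ 2 * Real.exp 2)))
    {L : ℕ} [NeZero L] {n : ℕ} (hL : L = 2 ^ (n + 1)) (h8 : 8 ≤ L) :
    DyadicAreaLaw ρ ρ β L n (N * (1 + 8 * |(32 : ℝ)| / ‖1 - ω‖ ^ 2)) (1 / 4) := by
  have hzc : ∀ g : G, z * g = g * z := fun g => (Subgroup.mem_center_iff.1 hz g).symm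
  have hdef : fluxDeficit ρ β L z plane01 ≤ 32 * (L : ℝ) ^ 2 * Real.exp (-(2 * (1 / 4) * (L : ℝ) ^ 2)) := by
    have h := CentralTwist.one_sub_twistedPartitionFunction_div_le_of_central (d := 4) (L := L) hzc ρ hρ hβ
      (i := 0) (j := 1) (by decide)
    have h' : fluxDeficit ρ β L z plane01 ≤ 2 * (4 : ℝ) ^ 2 * (L : ℝ) ^ (4 - 2) * Real.exp (-(1 / 2 * (L : ℝ) ^ 2)) := by
      simpa [fluxDeficit, plane01] using h
    refine h'.trans (le_of_eq ?_)
    norm_num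
  refine dyadicAreaLaw_of_flux ρ ρ hρ hN hL hz hne (CF := 32) (κ := 1 / 4) (by norm_num) ?_ ?_ hdef
  · have : (8 : ℝ) ≤ L := by exact_mod_cast h8
    norm_num; linarith
  · intro a b ha hb
    exact ty_self 4 L N ρ hρ n hL β 1 (by decide) z hz ω hω hω1 hne a b ha hb

/-- **The involution form** (the skeleton's original rung, `z² = 1`; e.g. `−1 ∈ SU(2)`, `Sp(n)`, `Spin`): a corollary of the central form —
the order hypothesis is not needed. -/
theorem dyadicAreaLaw_strongCoupling {N : ℕ} (ρ : G →* Matrix (Fin N) (Fin N) ℂ)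
    (hρ : Continuous ρ) (hN : 0 < N) {z : G} (hz : z ∈ Subgroup.center G) (_hz2 : z * z = 1) {ω : ℂ}
    (hω : ρ z = ω • (1 : Matrix (Fin N) (Fin N) ℂ)) (hω1 : ‖ω‖ = 1) (hne : ω ≠ 1) {β : ℝ}
    (hβ : |β| ≤ 1 / (4 * N * ((((8 * (4 - 1) : ℕ) : ℝ) + 1) ^ 2 * Real.exp 2)))
    {L : ℕ} [NeZero L] {n : ℕ} (hL : L = 2 ^ (n + 1)) (h8 : 8 ≤ L) :
    DyadicAreaLaw ρ ρ β L n (N * (1 + 8 * |(32 : ℝ)| / ‖1 - ω‖ ^ 2)) (1 / 4) :=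
  dyadicAreaLaw_strongCoupling_of_central ρ hρ hN hz hω hω1 hne hβ hL h8

end StrongCoupling

/-! ### The special-unitary fundamental models `SU(N)`, every `N ≥ 2`, twist `e^{2πi/N}·1` -/

section SUN

/-- The centre phase `e^{2πik∕N}` is `≠ 1` unless `k = 0` (`0 < N`). -/
theorem centerPhase_ne_one {N : ℕ} [NeZero N] {k : ZMod N} (hk : k ≠ 0) : centerPhase N k ≠ 1 := by
  intro h
  have hN : 0 < N := Nat.pos_of_ne_zero (NeZero.ne N)
  have hkv : k.val ≠ 0 := fun h0 => hk ((ZMod.val_eq_zero k).1 h0)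
  have hkN : k.val < N := ZMod.val_lt k
  unfold centerPhase at h
  rw [Complex.exp_eq_one_iff] at h
  obtain ⟨m, hm⟩ := h
  have him := congrArg Complex.im hm
  simp only [Complex.mul_im, Complex.ofReal_re, Complex.ofReal_im, Complex.I_re, Complex.I_im, mul_zero, mul_one,
    add_zero, Complex.mul_re, Complex.intCast_re, Complex.intCast_im, Complex.re_ofNat, Complex.im_ofNat,
    zero_mul, sub_zero] at him
  -- `him : 2π k.val / N = m · 2π`
  have hπ : 0 < Real.pi := Real.pi_pos
  have hNr : (0 : ℝ) < N := by exact_mod_cast hN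
  have hkr0 : (0 : ℝ) < k.val := by exact_mod_cast Nat.pos_of_ne_zero hkv
  have hkrN : (k.val : ℝ) < N := by exact_mod_cast hkN
  have hval : (k.val : ℝ) = m * N := by
    field_simp at him
    nlinarith [him, hπ]
  have hm0 : (0 : ℝ) < m := by
    by_contra hle; rw [not_lt] at hle; nlinarith
  have hm1 : (m : ℝ) < 1 := by
    by_contra hge; rw [not_lt] at hge; nlinarith
  have h0 : (0 : ℤ) < m := by exact_mod_cast hm0
  have h1 : m < (1 : ℤ) := by exact_mod_cast hm1
  omega

/-- **★★ `SU(N)` fundamental Wilson action, every `N ≥ 2`, at strong coupling: the vortex free energy of the twist `e^{2πi∕N}·1` floors a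
dyadic Wilson area law** (Ito–Seiler 2008 Thm 2.2 (1), `SU(N)` form — tree `CentralTwist.sun_one_sub_twistedPartitionFunction_div_le` — fed
through the Tomboulis–Yaffe junction): for `|β| ≤ 1∕(4N·25²·e²)`, on every dyadic 4-torus of side `L = 2^(n+1) ≥ 8`, every dyadic loop
up to half the side obeys `|⟨(tr W_{h×w})∕…⟩| ≤ N(1 + 256∕‖1 − e^{2πi∕N}‖²)·e^{−hw∕4}`.  Covers the odd `N` (no central involution). -/
theorem sun_dyadicAreaLaw_strongCoupling (N : ℕ) (hN : 2 ≤ N) {β : ℝ}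
    (hβ : |β| ≤ 1 / (4 * N * ((((8 * (4 - 1) : ℕ) : ℝ) + 1) ^ 2 * Real.exp 2)))
    {L : ℕ} [NeZero L] {n : ℕ} (hL : L = 2 ^ (n + 1)) (h8 : 8 ≤ L) :
    letI : MeasurableSpace (Matrix.specialUnitaryGroup (Fin N) ℂ) := borel _
    haveI : BorelSpace (Matrix.specialUnitaryGroup (Fin N) ℂ) := ⟨rfl⟩
    DyadicAreaLaw (fundamentalRep (Fin N)) (fundamentalRep (Fin N)) β L n
      (N * (1 + 8 * |(32 : ℝ)| / ‖1 - centerPhase N 1‖ ^ 2)) (1 / 4) := by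
  letI : MeasurableSpace (Matrix.specialUnitaryGroup (Fin N) ℂ) := borel _
  haveI : BorelSpace (Matrix.specialUnitaryGroup (Fin N) ℂ) := ⟨rfl⟩
  haveI : SecondCountableTopology (Matrix (Fin N) (Fin N) ℂ) :=
    inferInstanceAs (SecondCountableTopology (Fin N → Fin N → ℂ))
  haveI : SecondCountableTopology (Matrix.specialUnitaryGroup (Fin N) ℂ) :=
    TopologicalSpace.Subtype.secondCountableTopology _
  haveI : NeZero N := ⟨by omega⟩
  have hN0 : 0 < N := by omega
  have hz : ((suCenter N 1 : Matrix.specialUnitaryGroup (Fin N) ℂ)) ∈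
      Subgroup.center (Matrix.specialUnitaryGroup (Fin N) ℂ) := (suCenter N 1).2
  have hω : fundamentalRep (Fin N) (suCenter N 1 : Matrix.specialUnitaryGroup (Fin N) ℂ) =
      centerPhase N 1 • (1 : Matrix (Fin N) (Fin N) ℂ) := by
    rw [fundamentalRep_apply, coe_suCenter]
  have hne : centerPhase N 1 ≠ 1 := by
    refine centerPhase_ne_one ?_
    intro h10
    have := congrArg ZMod.val h10
    rw [ZMod.val_one'' (by omega), ZMod.val_zero] at this
    exact one_ne_zero this
  exact dyadicAreaLaw_strongCoupling_of_central (fundamentalRep (Fin N)) (continuous_fundamentalRep (Fin N)) hN0 hz hω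
    (norm_centerPhase N 1) hne hβ hL h8

end SUN

end Summit.QuantumFields.YangMills.Cruxes.IR.TensionRatio.Flux

end
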